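import Mathlib.LinearAlgebra.PiTensorProduct.Basic
import Mathlib.Topology.Algebra.RestrictedProduct.Basic
import Mathlib.Topology.Algebra.RestrictedProduct.TopologicalSpace
import Mathlib.Order.Filter.Cofinite
import Mathlib.RepresentationTheory.Basic
import Mathlib.RepresentationTheory.Irreducible
import Literature.NumberTheory.Automorphic.SmoothRepresentation
import HarnessLib

-- provenance: harness21/H21/H21/Prelude/AutomorphicAxiomatic/RestrictedTensorProduct.lean @ 2ef1752 (interim HEAD d8f2665); M5 mechanical rewrite
/-!
# Restricted tensor products (AutomorphicAxiomatic trunk, item C14 =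
`G19:RestrictedTensorProduct`)

Let `k` be a commutative ring, `V : ι → Type*` a family of `k`-modules and `x₀ : ∀ i, V i` a
family of *base vectors*. The **restricted tensor product** `⨂' (V i, x₀ i)` is the direct limit,
over finite sets `S ⊆ ι`, of the finite tensor products `⨂[k] i : S, V i`, with transition maps
inserting the base vectors `x₀ i` in the new slots (Flath, *Decomposition of representations
into tensor products*, Corvallis 1979, §2; Bump, *Automorphic forms and representations*,
§3.4). Following the architect's outline (D7) we do **not** construct it; we give a
*characterising predicate*:

* `RestrictedFamily V x₀`: families `x : ∀ i, V i` with `x i = x₀ i` for all but finitely many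
  `i`. This is Mathlib's `RestrictedProduct` with respect to the singletons `{x₀ i}` and the
  cofinite filter (so the coercion to functions, `RestrictedProduct.ext`, … are Mathlib's).
* `RestrictedFamily.update`, `RestrictedFamily.extend S m` (the family equal to `m` on the finite
  set `S` and to `x₀` off `S`).
* `IsRestrictedMultilinear j`: `j : RestrictedFamily V x₀ → W` is additive and homogeneous in
  each slot.
* `hj.liftFinset S : (⨂[k] i : S, V i) →ₗ[k] W`, the map `⊗ mᵢ ↦ j (extend S m)`
  (Mathlib `PiTensorProduct.lift`), and `liftFinset_tprod`.
* `IsRestrictedTensorProduct j S₀`: `j` is restricted-multilinear (`hj`), `hj.liftFinset S` is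
  injective for every finite `S ⊇ S₀`, and the ranges of the `hj.liftFinset S` exhaust `W`.
  This is the direct-limit definition verbatim.
* Equivariant version: for groups `G i` with subgroups `K i`, representations
  `ρ i : Representation k (G i) (V i)` and base vectors that are eventually `K i`-fixed, the
  restricted product group `Πʳ i, [G i, K i]` (Mathlib `RestrictedProduct`) acts on
  `RestrictedFamily V x₀` coordinatewise (`RestrictedFamily.smul`), and
  `IsRestrictedTensorProductRep ρ π hx₀ j S₀` says that `(W, π, j)` is a restricted tensor
  product of the `ρ i`.

## Main statements (proofs deferred)

* `exists_isRestrictedTensorProductRep`: existence of `(W, π, j)`.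
* `IsRestrictedTensorProductRep.unique`: any two are isomorphic by a unique compatible
  (automatically equivariant) linear isomorphism.
* `IsRestrictedTensorProductRep.isSmooth`, `.isAdmissible`, `.isIrreducible`: a restricted
  tensor product of smooth (resp. irreducible admissible, almost all spherical) representations
  is smooth (resp. admissible, irreducible) (Flath 1979, §2; Bump, Theorem 3.4.3 ff.).
* `IsRestrictedTensorProductRep.indep_of_base_vectors`: rescaling almost all base vectors by
  units gives an isomorphic representation (Flath 1979, Remark after Example 2).

## Mathlib declarations used rather than redefined

`RestrictedProduct` (and its group structure / topology on `Πʳ i, [G i, K i]`),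
`PiTensorProduct`, `PiTensorProduct.tprod`, `PiTensorProduct.lift`, `MultilinearMap`,
`Representation`, `Representation.IsIrreducible`, `Filter.cofinite`. Mathlib has no restricted
tensor product (grep `RestrictedTensor`, `restricted tensor` finds nothing). Smoothness,
admissibility, sphericity are H21's `Representation.IsSmooth`, `Representation.IsAdmissible`,
`Representation.IsSpherical`, `Representation.fixedPoints` (item C2).

## Design notes

* All declarations are in `namespace Literature.Automorphic` (trunk namespace, review F2).
* `IsRestrictedTensorProduct` existentially quantifies the multilinearity witness
  (`∃ hj : IsRestrictedMultilinear j, …`) so that `hj.liftFinset S` can be mentioned inside a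
  `Prop` without threading `hj` through the signature.
* The topological-group instances on `Πʳ i, [G i, K i]` in Mathlib need
  `Fact (∀ i, IsOpen (K i : Set (G i)))`; the predicates `IsSmooth`/`IsAdmissible` only need the
  topology, which Mathlib provides unconditionally, so the smoothness theorems simply take the
  hypothesis `hK : ∀ i, IsOpen (K i : Set (G i))` (and `[∀ i, IsTopologicalGroup (G i)]`, which
  is needed for "contains an open subgroup ⇒ open").
* `unique` and `indep_of_base_vectors` are stated over a commutative ring; existence,
  admissibility and irreducibility over a field.

## References

* D. Flath, *Decomposition of representations into tensor products*, Proc. Sympos. Pure Math.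
  33 (Corvallis 1979), part 1, 179–183, §2.
* D. Bump, *Automorphic forms and representations* (1997), §3.4.
-/

open scoped RestrictedProduct TensorProduct
open Filter PiTensorProduct

namespace Literature.NumberTheory.Automorphic

universe u uk uG v w w'

/-! ### Restricted families -/

section Family

variable {ι : Type u} (V : ι → Type v) (x₀ : ∀ i, V i)

/-- A **restricted family** with respect to base vectors `x₀ : ∀ i, V i`: a family
`x : ∀ i, V i` with `x i = x₀ i` for all but finitely many `i`. This is Mathlib's restricted
product `Πʳ i, [V i, {x₀ i}]` with respect to the singletons `{x₀ i}` and the cofinite filter;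
restricted-multilinear maps out of it model maps out of the restricted tensor product.
(Flath 1979, §2; Bump 1997, §3.4.) [cite: Flath1979, §2] -/
abbrev RestrictedFamily : Type _ := Πʳ i, [V i, ({x₀ i} : Set (V i))]

namespace RestrictedFamily

variable {V x₀}

/-- A restricted family agrees with the base vectors off a finite set. [folklore] -/
lemma eventually_eq (x : RestrictedFamily V x₀) : ∀ᶠ i in cofinite, x i = x₀ i := x.2

variable (x₀) in
/-- The base family `x₀` itself, as a restricted family. (Flath 1979, §2.) [cite: Flath1979, §2] -/
def base : RestrictedFamily V x₀ := RestrictedProduct.mk x₀ (Eventually.of_forall fun _ => rfl)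

/-- Coordinates of the base family. [folklore] -/
@[simp] lemma base_apply (i : ι) : (base x₀ : RestrictedFamily V x₀) i = x₀ i := rfl

variable [DecidableEq ι]

/-- Change the `i`-th coordinate of a restricted family to `v` (`Function.update`); the result is
still eventually equal to `x₀`. (Flath 1979, §2.) [cite: Flath1979, §2] -/
def update (x : RestrictedFamily V x₀) (i : ι) (v : V i) : RestrictedFamily V x₀ :=
  RestrictedProduct.mk (Function.update (⇑x) i v) <|
    (x.eventually_eq.and (eventually_cofinite_ne i)).mono fun j hj => by
      simp only [Set.mem_singleton_iff, Function.update_of_ne hj.2, hj.1]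

/-- Coordinates of an updated family. [folklore] -/
@[simp] lemma update_apply (x : RestrictedFamily V x₀) (i : ι) (v : V i) (j : ι) :
    x.update i v j = Function.update (⇑x) i v j := rfl

/-- The coercion of an updated family is `Function.update`. [folklore] -/
@[simp] lemma coe_update (x : RestrictedFamily V x₀) (i : ι) (v : V i) :
    ⇑(x.update i v) = Function.update (⇑x) i v := rfl

/-- Extend a finite family `m : ∀ i : S, V i` on a finset `S` by the base vectors off `S`.
This is the map `∏_{i ∈ S} V i → RestrictedFamily V x₀` through which the finite tensor
products map to the restricted tensor product. (Flath 1979, §2; Bump 1997, §3.4.) [cite: Flath1979, §2] -/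
def extend (S : Finset ι) (m : ∀ i : S, V i) : RestrictedFamily V x₀ :=
  RestrictedProduct.mk (fun i => if h : i ∈ S then m ⟨i, h⟩ else x₀ i) <|
    S.eventually_cofinite_notMem.mono fun i hi => by simp [hi]

/-- Coordinates of `extend S m` on `S`. [folklore] -/
@[simp] lemma extend_apply_of_mem (S : Finset ι) (m : ∀ i : S, V i) {i : ι} (hi : i ∈ S) :
    extend (x₀ := x₀) S m i = m ⟨i, hi⟩ := by
  simp [extend, hi]

/-- Coordinates of `extend S m` at an element of `S`. [folklore] -/
lemma extend_apply_coe (S : Finset ι) (m : ∀ i : S, V i) (i : S) :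
    extend (x₀ := x₀) S m i = m i := by
  simp [extend, i.2]

/-- Coordinates of `extend S m` off `S` are the base vectors. [folklore] -/
@[simp] lemma extend_apply_of_notMem (S : Finset ι) (m : ∀ i : S, V i) {i : ι} (hi : i ∉ S) :
    extend (x₀ := x₀) S m i = x₀ i := by
  simp [extend, hi]

/-- `extend` commutes with `Function.update` (for an arbitrary decidable-equality instance on
`↥S`, as required by `MultilinearMap`). [folklore] -/
lemma extend_update (S : Finset ι) {instS : DecidableEq ↥S} (m : ∀ i : S, V i) (i : S)
    (v : V i) :
    extend (x₀ := x₀) S (Function.update m i v) = (extend S m).update (i : ι) v := by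
  ext j
  by_cases hj : j ∈ S
  · rw [extend_apply_of_mem _ _ hj, update_apply]
    by_cases hji : (⟨j, hj⟩ : S) = i
    · subst hji
      simp
    · have hji' : j ≠ (i : ι) := fun h => hji (Subtype.ext h)
      rw [Function.update_of_ne hji, Function.update_of_ne hji', extend_apply_of_mem _ _ hj]
  · have hji' : j ≠ (i : ι) := fun h => hj (h ▸ i.2)
    rw [extend_apply_of_notMem _ _ hj, update_apply, Function.update_of_ne hji',
      extend_apply_of_notMem _ _ hj]

end RestrictedFamily

end Family

/-! ### Restricted-multilinear maps and the characterising predicate -/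

section Multilinear

variable {ι : Type u} {k : Type uk} [CommRing k] {V : ι → Type v} [∀ i, AddCommGroup (V i)]
  [∀ i, Module k (V i)] {x₀ : ∀ i, V i} {W : Type w} [AddCommGroup W] [Module k W]
  [DecidableEq ι]

variable (k) in
/-- A map `j : RestrictedFamily V x₀ → W` is **restricted-multilinear** if it is additive and
`k`-homogeneous in each coordinate separately (the other coordinates, all but finitely many of
which are base vectors, being fixed). Such `j` correspond to linear maps out of the restricted
tensor product. (Flath 1979, §2; Bump 1997, §3.4.) [cite: Flath1979, §2] -/
structure IsRestrictedMultilinear (j : RestrictedFamily V x₀ → W) : Prop where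
  /-- Additivity in each coordinate. -/
  map_update_add : ∀ (x : RestrictedFamily V x₀) (i : ι) (v w : V i),
    j (x.update i (v + w)) = j (x.update i v) + j (x.update i w)
  /-- Homogeneity in each coordinate. -/
  map_update_smul : ∀ (x : RestrictedFamily V x₀) (i : ι) (c : k) (v : V i),
    j (x.update i (c • v)) = c • j (x.update i v)

namespace IsRestrictedMultilinear

variable {j : RestrictedFamily V x₀ → W}

/-- The multilinear map `m ↦ j (extend S m)` on `∀ i : S, V i` obtained by restricting a
restricted-multilinear map to the coordinates in a finset `S` (base vectors elsewhere).
(Flath 1979, §2.) [cite: Flath1979, §2] -/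
def restrictMultilinear (hj : IsRestrictedMultilinear k j) (S : Finset ι) :
    MultilinearMap k (fun i : S => V i) W where
  toFun m := j (RestrictedFamily.extend S m)
  map_update_add' m i x y := by
    simp only [RestrictedFamily.extend_update, hj.map_update_add]
  map_update_smul' m i c x := by
    simp only [RestrictedFamily.extend_update, hj.map_update_smul]

/-- Unfolding lemma for `restrictMultilinear`. [folklore] -/
@[simp] lemma restrictMultilinear_apply (hj : IsRestrictedMultilinear k j) (S : Finset ι)
    (m : ∀ i : S, V i) : hj.restrictMultilinear S m = j (RestrictedFamily.extend S m) := rfl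

/-- The linear map `(⨂[k] i : S, V i) →ₗ[k] W`, `⊗ᵢ mᵢ ↦ j (extend S m)`, induced by a
restricted-multilinear `j` on the finite tensor product over a finset `S`
(Mathlib `PiTensorProduct.lift`). These are the structure maps from the terms of the direct
system `S ↦ ⨂_{i ∈ S} V i` to `W`. (Flath 1979, §2; Bump 1997, §3.4.) [cite: Flath1979, §2] -/
noncomputable def liftFinset (hj : IsRestrictedMultilinear k j) (S : Finset ι) :
    (⨂[k] i : S, V i) →ₗ[k] W :=
  PiTensorProduct.lift (hj.restrictMultilinear S)

/-- `liftFinset` on pure tensors (`PiTensorProduct.lift.tprod`). [folklore] -/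
@[simp] lemma liftFinset_tprod (hj : IsRestrictedMultilinear k j) (S : Finset ι)
    (m : ∀ i : S, V i) : hj.liftFinset S (tprod k m) = j (RestrictedFamily.extend S m) := by
  simp [liftFinset]

end IsRestrictedMultilinear

variable (k) in
/-- **Restricted tensor product, characterising predicate.** `(W, j)` is a restricted tensor
product `⨂'_i (V i, x₀ i)` with exceptional finite set `S₀` if `j : RestrictedFamily V x₀ → W`
is restricted-multilinear, the induced maps `hj.liftFinset S : ⨂[k] i : S, V i → W` are
injective for all finite `S ⊇ S₀`, and their ranges exhaust `W`. This is verbatim the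
description of `W` as the direct limit `lim_{S} ⨂_{i ∈ S} V i` along the maps inserting base
vectors (outline D7). The multilinearity witness is quantified existentially so that the
predicate is a `Prop` in `j` and `S₀` alone. (Flath 1979, §2; Bump 1997, §3.4.) [cite: Flath1979, §2] -/
def IsRestrictedTensorProduct (j : RestrictedFamily V x₀ → W) (S₀ : Finset ι) : Prop :=
  ∃ hj : IsRestrictedMultilinear k j,
    (∀ S : Finset ι, S₀ ⊆ S → Function.Injective (hj.liftFinset S)) ∧
      ⨆ S : Finset ι, LinearMap.range (hj.liftFinset S) = ⊤

/-- A restricted tensor product map is restricted-multilinear. [folklore] -/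
lemma IsRestrictedTensorProduct.isRestrictedMultilinear {j : RestrictedFamily V x₀ → W}
    {S₀ : Finset ι} (h : IsRestrictedTensorProduct k j S₀) : IsRestrictedMultilinear k j :=
  h.1

/-- In a restricted tensor product the maps from the finite tensor products over `S ⊇ S₀` are
injective. [folklore] -/
lemma IsRestrictedTensorProduct.injective_liftFinset {j : RestrictedFamily V x₀ → W}
    {S₀ : Finset ι} (h : IsRestrictedTensorProduct k j S₀) {S : Finset ι} (hS : S₀ ⊆ S) :
    Function.Injective (h.isRestrictedMultilinear.liftFinset S) :=
  h.2.1 S hS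

/-- In a restricted tensor product the ranges of the maps from the finite tensor products
exhaust `W`. [folklore] -/
lemma IsRestrictedTensorProduct.iSup_range_liftFinset {j : RestrictedFamily V x₀ → W}
    {S₀ : Finset ι} (h : IsRestrictedTensorProduct k j S₀) :
    ⨆ S : Finset ι, LinearMap.range (h.isRestrictedMultilinear.liftFinset S) = ⊤ :=
  h.2.2

/-- A restricted tensor product with exceptional set `S₀` is one for any larger finite set. [folklore] -/
lemma IsRestrictedTensorProduct.mono {j : RestrictedFamily V x₀ → W} {S₀ S₁ : Finset ι}
    (h : IsRestrictedTensorProduct k j S₀) (hS : S₀ ⊆ S₁) : IsRestrictedTensorProduct k j S₁ :=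
  ⟨h.1, fun S hS' => h.2.1 S (hS.trans hS'), h.2.2⟩

end Multilinear

/-! ### The equivariant version -/

section Rep

variable {ι : Type u} {k : Type uk} [CommRing k] {G : ι → Type uG} [∀ i, Group (G i)]
  {K : ∀ i, Subgroup (G i)} {V : ι → Type v} [∀ i, AddCommGroup (V i)] [∀ i, Module k (V i)]
  (ρ : ∀ i, Representation k (G i) (V i)) {x₀ : ∀ i, V i}

/-- The coordinatewise action of the restricted product group `Πʳ i, [G i, K i]` (Mathlib
`RestrictedProduct` of the `G i` with respect to the subgroups `K i`) on restricted families: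
`(g • x) i = ρ i (g i) (x i)`. This is again a restricted family because eventually
`g i ∈ K i`, `x i = x₀ i` and `x₀ i` is `K i`-fixed (hypothesis `hx₀`).
(Flath 1979, §2, Example 2; Bump 1997, §3.4.) [cite: Flath1979, §2  Example 2] -/
def RestrictedFamily.smul (hx₀ : ∀ᶠ i in cofinite, x₀ i ∈ (ρ i).fixedPoints (K i))
    (g : Πʳ i, [G i, K i]) (x : RestrictedFamily V x₀) : RestrictedFamily V x₀ :=
  RestrictedProduct.mk (fun i => ρ i (g i) (x i)) <|
    ((hx₀.and g.2).and x.eventually_eq).mono fun i hi => by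
      obtain ⟨⟨h₀, hg⟩, hx⟩ := hi
      rw [Set.mem_singleton_iff, hx]
      exact ((ρ i).mem_fixedPoints (K i) (x₀ i)).1 h₀ (g i) hg

/-- Coordinates of `RestrictedFamily.smul`. [folklore] -/
@[simp] lemma RestrictedFamily.smul_apply
    (hx₀ : ∀ᶠ i in cofinite, x₀ i ∈ (ρ i).fixedPoints (K i)) (g : Πʳ i, [G i, K i])
    (x : RestrictedFamily V x₀) (i : ι) :
    RestrictedFamily.smul ρ hx₀ g x i = ρ i (g i) (x i) := rfl

/-- The identity acts trivially. [folklore] -/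
@[simp] lemma RestrictedFamily.one_smul
    (hx₀ : ∀ᶠ i in cofinite, x₀ i ∈ (ρ i).fixedPoints (K i)) (x : RestrictedFamily V x₀) :
    RestrictedFamily.smul ρ hx₀ 1 x = x := by
  ext i; simp

/-- The coordinatewise action is multiplicative. [folklore] -/
lemma RestrictedFamily.mul_smul
    (hx₀ : ∀ᶠ i in cofinite, x₀ i ∈ (ρ i).fixedPoints (K i)) (g h : Πʳ i, [G i, K i])
    (x : RestrictedFamily V x₀) :
    RestrictedFamily.smul ρ hx₀ (g * h) x =
      RestrictedFamily.smul ρ hx₀ g (RestrictedFamily.smul ρ hx₀ h x) := by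
  ext i; simp

variable [DecidableEq ι] {W : Type w} [AddCommGroup W] [Module k W]

/-- **Restricted tensor product of representations, characterising predicate.** A
representation `π` of the restricted product group `Πʳ i, [G i, K i]` on `W`, together with
`j : RestrictedFamily V x₀ → W`, is a restricted tensor product `⨂'_i (ρ i, x₀ i)` (with
exceptional set `S₀`) if `(W, j)` is a restricted tensor product of the modules `V i` and `j`
is equivariant for the coordinatewise action: `j (g • x) = π g (j x)`.
(Flath 1979, §2, Example 2; Bump 1997, §3.4.) [cite: Flath1979, §2  Example 2] -/
def IsRestrictedTensorProductRep (π : Representation k (Πʳ i, [G i, K i]) W)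
    (hx₀ : ∀ᶠ i in cofinite, x₀ i ∈ (ρ i).fixedPoints (K i)) (j : RestrictedFamily V x₀ → W)
    (S₀ : Finset ι) : Prop :=
  IsRestrictedTensorProduct k j S₀ ∧
    ∀ (g : Πʳ i, [G i, K i]) (x : RestrictedFamily V x₀),
      j (RestrictedFamily.smul ρ hx₀ g x) = π g (j x)

variable {ρ}

/-- The underlying module of a restricted tensor product representation is a restricted tensor
product. [folklore] -/
lemma IsRestrictedTensorProductRep.isRestrictedTensorProduct
    {π : Representation k (Πʳ i, [G i, K i]) W}
    {hx₀ : ∀ᶠ i in cofinite, x₀ i ∈ (ρ i).fixedPoints (K i)} {j : RestrictedFamily V x₀ → W}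
    {S₀ : Finset ι} (h : IsRestrictedTensorProductRep ρ π hx₀ j S₀) :
    IsRestrictedTensorProduct k j S₀ :=
  h.1

/-- Equivariance of the structure map of a restricted tensor product representation. [folklore] -/
lemma IsRestrictedTensorProductRep.map_smul {π : Representation k (Πʳ i, [G i, K i]) W}
    {hx₀ : ∀ᶠ i in cofinite, x₀ i ∈ (ρ i).fixedPoints (K i)} {j : RestrictedFamily V x₀ → W}
    {S₀ : Finset ι} (h : IsRestrictedTensorProductRep ρ π hx₀ j S₀) (g : Πʳ i, [G i, K i])
    (x : RestrictedFamily V x₀) : j (RestrictedFamily.smul ρ hx₀ g x) = π g (j x) :=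
  h.2 g x

end Rep

/-! ### Existence, uniqueness and properties (proofs deferred) -/

section Theorems

variable {ι : Type u} {k : Type uk} [CommRing k] {G : ι → Type uG} [∀ i, Group (G i)]
  {K : ∀ i, Subgroup (G i)} {V : ι → Type v} [∀ i, AddCommGroup (V i)] [∀ i, Module k (V i)]
  {ρ : ∀ i, Representation k (G i) (V i)} {x₀ : ∀ i, V i} [DecidableEq ι]
  {W : Type w} [AddCommGroup W] [Module k W] {W' : Type w'} [AddCommGroup W']
  [Module k W'] {π : Representation k (Πʳ i, [G i, K i]) W}
  {π' : Representation k (Πʳ i, [G i, K i]) W'}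
  {hx₀ : ∀ᶠ i in cofinite, x₀ i ∈ (ρ i).fixedPoints (K i)}
  {j : RestrictedFamily V x₀ → W} {j' : RestrictedFamily V x₀ → W'} {S₀ S₀' : Finset ι}

/-- **Uniqueness of the restricted tensor product** (universal property of the direct limit):
two restricted tensor products `(W, π, j)`, `(W', π', j')` of the same family with the same base
vectors (over any commutative ring) are isomorphic by a *unique* linear isomorphism `e` with
`e ∘ j = j'`, and this `e` is equivariant. Uniqueness of `e` holds because the ranges of the
`liftFinset` exhaust `W`. (Flath 1979, §2; Bump 1997, §3.4.) [cite: Flath1979, §2] -/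
def IsRestrictedTensorProductRep.unique : Prop :=
  ∀ (h : IsRestrictedTensorProductRep ρ π hx₀ j S₀) (h' : IsRestrictedTensorProductRep ρ π' hx₀ j' S₀'),
    ∃! e : W ≃ₗ[k] W', (∀ x, e (j x) = j' x) ∧
      ∀ g : Πʳ i, [G i, K i], (e : W →ₗ[k] W') ∘ₗ π g = π' g ∘ₗ (e : W →ₗ[k] W')

/-- **Independence of the base vectors.** If `x₀'` is another family of base vectors which,
for almost all `i`, is a unit multiple of `x₀ i` (as happens when both are non-zero vectors of
the one-dimensional `K i`-fixed line of a spherical representation), then restricted tensor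
products with respect to `x₀` and `x₀'` are isomorphic as representations of
`Πʳ i, [G i, K i]` (over any commutative ring).
(Flath 1979, §2, Remark following Example 2; Bump 1997, §3.4.) [cite: Flath1979, §2  Remark following Example 2] -/
def IsRestrictedTensorProductRep.indep_of_base_vectors : Prop :=
  ∀ {x₀' : ∀ i, V i} {hx₀' : ∀ᶠ i in cofinite, x₀' i ∈ (ρ i).fixedPoints (K i)} {j'' : RestrictedFamily V x₀' → W'} (hc : ∀ᶠ i in cofinite, ∃ c : kˣ, x₀' i = c • x₀ i) (h : IsRestrictedTensorProductRep ρ π hx₀ j S₀) (h' : IsRestrictedTensorProductRep ρ π' hx₀' j'' S₀'),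
    ∃ e : W ≃ₗ[k] W',
      ∀ g : Πʳ i, [G i, K i], (e : W →ₗ[k] W') ∘ₗ π g = π' g ∘ₗ (e : W →ₗ[k] W')

variable [∀ i, TopologicalSpace (G i)] [∀ i, IsTopologicalGroup (G i)]

/-- A restricted tensor product of smooth representations of topological groups `G i`, with
respect to open subgroups `K i`, is a smooth representation of the restricted product group
(with Mathlib's restricted product topology): the stabiliser of `j x` contains the open
subgroup `∏_{i ∈ S} Stab(x i) × ∏_{i ∉ S} K i`, hence is open (this last step uses continuity
of translations in each `G i`, i.e. `IsTopologicalGroup`; the statement fails for bare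
topological spaces). (Flath 1979, §2, Example 2; Bump 1997, §3.4.) [cite: Flath1979, §2  Example 2] -/
def IsRestrictedTensorProductRep.isSmooth : Prop :=
  ∀ (hK : ∀ i, IsOpen (K i : Set (G i))) (hρ : ∀ i, (ρ i).IsSmooth) (h : IsRestrictedTensorProductRep ρ π hx₀ j S₀),
    π.IsSmooth

end Theorems

section TheoremsField

variable {ι : Type u} {k : Type uk} [Field k] {G : ι → Type uG} [∀ i, Group (G i)]
  {K : ∀ i, Subgroup (G i)} {V : ι → Type v} [∀ i, AddCommGroup (V i)] [∀ i, Module k (V i)]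
  {ρ : ∀ i, Representation k (G i) (V i)} {x₀ : ∀ i, V i} [DecidableEq ι]

/-- **Existence of the restricted tensor product.** Over a field, if the base vectors are
eventually `K i`-fixed (`hx₀`) and non-zero off a finite set `S₀`, there is a representation
`π` of `Πʳ i, [G i, K i]` on a space `W` and an equivariant restricted-multilinear
`j : RestrictedFamily V x₀ → W` making `(W, π, j)` a restricted tensor product of the `ρ i`
with exceptional set `S₀` (namely `W = lim_S ⨂_{i ∈ S} V i`; non-vanishing of `x₀ i` off `S₀`
makes the transition maps over `S ⊇ S₀` injective). (Flath 1979, §2; Bump 1997, §3.4.) [cite: Flath1979, §2] -/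
def exists_isRestrictedTensorProductRep : Prop :=
  ∀ (ρ : ∀ i, Representation k (G i) (V i)) (S₀ : Finset ι) (hx₀ : ∀ᶠ i in cofinite, x₀ i ∈ (ρ i).fixedPoints (K i)) (hS₀ : ∀ i ∉ S₀, x₀ i ≠ 0),
    ∃ (W : Type (max u uk v)) (_ : AddCommGroup W) (_ : Module k W)
      (π : Representation k (Πʳ i, [G i, K i]) W) (j : RestrictedFamily V x₀ → W),
      IsRestrictedTensorProductRep ρ π hx₀ j S₀

variable {W : Type w} [AddCommGroup W] [Module k W] {π : Representation k (Πʳ i, [G i, K i]) W}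
  {hx₀ : ∀ᶠ i in cofinite, x₀ i ∈ (ρ i).fixedPoints (K i)}
  {j : RestrictedFamily V x₀ → W} {S₀ : Finset ι} [∀ i, TopologicalSpace (G i)]

/-- A restricted tensor product of admissible representations of topological groups, almost
all of which are spherical with respect to compact open subgroups `K i` (with `x₀ i` spanning
the `K i`-fixed line), is admissible. (Flath 1979, §2, Example 2; Bump 1997, Theorem 3.4.3
and §3.4.) [cite: Flath1979, §2  Example 2] -/
def IsRestrictedTensorProductRep.isAdmissible : Prop :=
  ∀ [∀ i, IsTopologicalGroup (G i)] (hK : ∀ i, IsOpen (K i : Set (G i))) (hKc : ∀ i, IsCompact (K i : Set (G i))) (hρ : ∀ i, (ρ i).IsAdmissible) (hsph : ∀ᶠ i in cofinite, (ρ i).IsSpherical (K i) ∧ x₀ i ≠ 0) (h : IsRestrictedTensorProductRep ρ π hx₀ j S₀),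
    π.IsAdmissible

/-- **Flath's theorem (easy direction).** Over an algebraically closed field, a restricted
tensor product of irreducible admissible representations of locally profinite groups, almost all
spherical with respect to compact open `K i` with `x₀ i` a spherical vector, is irreducible
(and admissible, `IsRestrictedTensorProductRep.isAdmissible`).
(Flath 1979, Theorem 2 / Example 2; Bump 1997, Theorem 3.4.4.) [cite: Flath1979, Theorem 2 / Example 2] -/
def IsRestrictedTensorProductRep.isIrreducible : Prop :=
  ∀ [IsAlgClosed k] [∀ i, NonarchimedeanGroup (G i)] [∀ i, LocallyCompactSpace (G i)] [∀ i, T2Space (G i)] (hK : ∀ i, IsOpen (K i : Set (G i))) (hKc : ∀ i, IsCompact (K i : Set (G i))) (hirr : ∀ i, (ρ i).IsIrreducible) (hρ : ∀ i, (ρ i).IsAdmissible) (hsph : ∀ᶠ i in cofinite, (ρ i).IsSpherical (K i) ∧ x₀ i ≠ 0) (h : IsRestrictedTensorProductRep ρ π hx₀ j S₀),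
    π.IsIrreducible

end TheoremsField

end Literature.NumberTheory.Automorphic
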